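/-
Copyright (c) 2026 the pub-hodgecm-mathlib formalisation cell (harness21).  Prover seat hodgecm-mathlib-K2Liu-p08 (g0), Track B «K2-LIT»,
#184♮ = hLiu418 = `stmt-HodgeConjecture-24832`; LEAD F0P6-plan (g11) DEALS-req649 (S2′) «#33b (a) (B)», part (B3) «transport to the
`localPi ∕ siegelDeltaLoc v ∕ iotaLeftLocPi` currency» (box 05:32:24Z; RE-DEAL (D-fin) 05:43:59Z).  File (B-iii); inputs ★ (B-i) p857682
`K2LiuSiegelMainOrbitDecompositionLoc`, ★ (B-ii) p857705 `K2LiuSiegelBigCellOpenEmbedding`, ★ `UnitaryGroupDualPairLine`.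
-/
import Summits.HodgeConjecture.HodgeConjecture.Theorems.K2LiuSiegelBigCellOpenEmbedding   -- ★ (B-ii) p857705 (imports ★ (B-i) p857682)
import Literature.NumberTheory.K2Lit.LocalDoublingSiegel                               -- ★ `siegelDeltaLoc`, `mem_siegelDeltaLoc_iff_isSiegelM`
import Literature.NumberTheory.Automorphic.UnitaryGroupDualPairLine                    -- ★ `isHomeomorph_dualPairInl_of_line`
import HarnessLib

/-!
# Crux `HLiu418`, road `K2_Liu`, socket #33b organ (a), file (B-iii): the main-orbit open embedding in the
# `localPi ∕ siegelDeltaLoc v ∕ iotaLeftLocPi` currency (`M = 1`): `P_Δ(L⁺_v) × U(V)(L⁺_v) → H(L⁺_v)`, `(p, g) ↦ p · ι_v(g, 1)`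

Cell `hodgecm-mathlib`, crux item hLiu418 = `stmt-HodgeConjecture-24832`; LEAD F0P6-plan (g11), box K2E5-r01 (g6); consumer = the (D-fin)
local-section file `K2LiuSiegelMainOrbitLocalSection` (K2E2-p12 (g3) HANDOFF-33b-D §«What remains» 1: inputs `(hΩ : IsOpenMap …) (hinj)` BY
VALUE in this currency) and the #33b closer.  THEOREMS ONLY (no `def`, no instance, no notation, no named-fact hypothesis, no `sorry`);
lane `--supports stmt-HodgeConjecture-24832 --as helper` (count-neutral).

SETTING.  As in (B-i)∕(B-ii), at `M = 1` (`e : Fin N × Fin 1 ≃ Fin n`, `dW : Fin 1 → L`): the factor forms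
`H_v := UnitaryGroup.localPi L c (n + n) (hermD …) v` and `G_v := UnitaryGroup.localPi L c N (diagonal dV) v` (★ `UnitaryGroupLocalFactors`),
`P_{Δ,v} := siegelDeltaLoc … v ≤ H_v` (★ `K2Lit/LocalDoublingSiegel`), `ι_v(·, 1) := iotaLeftLocPi … v : G_v →* H_v` (★ `K2Lit/LocalDoublingEmbedding`).
The TRANSPORT to the «local» coordinates of (B-i)∕(B-ii) is along the three ★ homeomorphisms `Φ := localPiEquiv … (n + n) (hermD …) v`,
`Φ_N := localPiEquiv … N (diagonal dV) v` (★ `ContinuousMulEquiv`s) and `ψ := dualPairInl c_v (J_V)_v (J_W)_v : U(V)_v → localPairU … v`,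
`g ↦ g ⊗ 1`, a HOMEOMORPHISM for a hermitian LINE `W` (★ `UnitaryGroup.isHomeomorph_dualPairInl_of_line`, needs `dW 0 ≠ 0`):
`Φ (p · ι_v(g, 1)) = Φ p · ι_v(ψ(Φ_N g), 1)` (`localPiEquiv_mul_iotaLeftLocPi`), so the chart of this file is
`Φ⁻¹ ∘ (chart of (B-ii)) ∘ (θ × ψ Φ_N)` with `θ : P_{Δ,v} ≃ₜ {p′ // IsSiegelM p′}` (`mem_siegelDeltaLoc_iff_isSiegelM_localPiEquiv`).

* §1 `IsSiegelM` over `L_v = Π_w L_w` is `IsSiegelM` at every `w` (`isSiegelM_iff_forall_map_eval`); membership in `siegelDeltaLoc v` is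
  `IsSiegelM (Φ u)`; `P_{Δ,v}` is CLOSED; the chart identity.
* §2 **`(p, g) ↦ p · ι_v(g, 1)` on `P_{Δ,v} × G_v` is injective (`injective_siegelDeltaLoc_mul_iotaLeftLocPi`), an OPEN MAP and an OPEN
  EMBEDDING (`isOpenMap_…`, `isOpenEmbedding_siegelDeltaLoc_mul_iotaLeftLocPi`, hyps `dW 0 ≠ 0`, `IsUnit (det 𝕁_v)`) with RANGE the main
  orbit `{u | IsUnit M(Φ u)}` (`range_…`)**; (D1) `P_{Δ,v} · ι_v(C, 1)` is CLOSED for compact `C ⊆ G_v`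
  (`isClosed_image_siegelDeltaLoc_mul_iotaLeftLocPi_of_isCompact`, hypothesis-free).
* §3 `IsUnit (det 𝕁_v)` for `dV i ≠ 0`, `dW j ≠ 0` (`isUnit_det_pairFormLoc`, any `N, M`) — discharges `hJ` of (B-i)∕(B-ii)∕§2.

[GelbartPiatetskishapiroRallis1987, Part A §1–§2] [Liu2021, §B.3 (B.5), Lem. B.11, App. D §D.1] [HarrisKudlaSweet1996, §1 (1.11)] [Liu2011, §2C p. 863].
HONEST LABEL.  Count-neutral helper; `HC_CM` is proved only modulo the 7 printed citations (2 remaining named inputs: hLiu418 =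
`stmt-HodgeConjecture-24832`, h413 = `stmt-HodgeConjecture-24833`) until rung 0 closes.
-/

set_option autoImplicit false
set_option linter.dupNamespace false -- the mandated namespace repeats `HodgeConjecture.HodgeConjecture`

noncomputable section

namespace Summit.HodgeConjecture.HodgeConjecture.Cruxes.HLiu418.K2LiuSiegelBigCellOpenEmbeddingPi

open scoped Matrix Pointwise Kronecker
open Topology Filter
open NumberField IsDedekindDomain
open Literature.NumberTheory.Automorphic
open Literature.NumberTheory.GelbartRogawski1991 Literature.NumberTheory.GelbartRogawski1991.GRConstruction
open Literature.NumberTheory.K2Lit.SiegelDoubled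
open Summit.HodgeConjecture.HodgeConjecture.Cruxes.HLiu418.K2LiuSiegelMainOrbitDecompositionLoc
open Summit.HodgeConjecture.HodgeConjecture.Cruxes.HLiu418.K2LiuSiegelBigCellOpenEmbedding

/-! ## §1 Siegel membership and the chart identity along `localPiEquiv` -/

section PiLocal

variable (L : Type) [Field L] [NumberField L] [IsCMField L]
variable {N n : ℕ} (e : Fin N × Fin 1 ≃ Fin n)
  (dV : Fin N → L) (hdV : ∀ i, IsCMField.complexConj L (dV i) = dV i)
  (dW : Fin 1 → L) (hdW : ∀ i, IsCMField.complexConj L (dW i) = dW i)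
  (v : HeightOneSpectrum (𝓞 (Fp L)))

omit [IsCMField L] in
/-- the Siegel relation over `L_v = Π_{w ∣ v} L_w` holds iff it holds at every `w ∣ v` (it is entrywise). [cite: GelbartRogawski1991, §3.1 Prop. 3.1.1] -/
theorem isSiegelM_iff_forall_map_eval (X : Matrix (Fin (n + n)) (Fin (n + n)) (UnitaryGroup.LocalRing L v)) :
    IsSiegelM (n := n) X ↔ ∀ w : UnitaryGroup.PlacesOver L v,
      IsSiegelM (n := n) (X.map (Pi.evalRingHom (fun w : UnitaryGroup.PlacesOver L v => w.1.adicCompletion L) w)) := by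
  simp only [isSiegelM_iff_entry, Matrix.map_apply, Pi.evalRingHom_apply, funext_iff, Pi.add_apply]
  exact ⟨fun h w i j => h i j w, fun h i j w => h w i j⟩

/-- **membership in `P_Δ(L⁺_v) = siegelDeltaLoc v` is the Siegel relation of the regrouped matrix `Φ u`** (★ `mem_siegelDeltaLoc_iff_isSiegelM`
place by place + ★ `GLn.map_piEquiv_symm`). [cite: Kudla1994, §3] [cite: HarrisKudlaSweet1996, §1 (1.11)] -/
theorem mem_siegelDeltaLoc_iff_isSiegelM_localPiEquiv
    (u : UnitaryGroup.localPi L (IsCMField.complexConj L) (n + n) (hermD L e dV hdV dW hdW) v) :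
    u ∈ siegelDeltaLoc L e dV hdV dW hdW v ↔
      IsSiegelM (n := n) (Units.val (Subtype.val
        (UnitaryGroup.localPiEquiv L (IsCMField.complexConj L) (n + n) (hermD L e dV hdV dW hdW) v u))) := by
  rw [mem_siegelDeltaLoc_iff_isSiegelM, isSiegelM_iff_forall_map_eval]
  exact Iff.rfl

/-- **`P_Δ(L⁺_v)` is CLOSED in `H(L⁺_v)`** (preimage of ★ (B-ii) `isClosed_setOf_isSiegelM` under the homeomorphism `Φ`).
[cite: GelbartRogawski1991, §3.1 Prop. 3.1.1] -/
theorem isClosed_siegelDeltaLoc :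
    IsClosed (siegelDeltaLoc L e dV hdV dW hdW v :
      Set (UnitaryGroup.localPi L (IsCMField.complexConj L) (n + n) (hermD L e dV hdV dW hdW) v)) := by
  have hset : (siegelDeltaLoc L e dV hdV dW hdW v :
      Set (UnitaryGroup.localPi L (IsCMField.complexConj L) (n + n) (hermD L e dV hdV dW hdW) v)) =
      (fun u => UnitaryGroup.localPiEquiv L (IsCMField.complexConj L) (n + n) (hermD L e dV hdV dW hdW) v u) ⁻¹'
        {p : UnitaryGroup.«local» L (IsCMField.complexConj L) (n + n) (hermD L e dV hdV dW hdW) v |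
          IsSiegelM (n := n) (Units.val (Subtype.val p))} := by
    ext u
    exact mem_siegelDeltaLoc_iff_isSiegelM_localPiEquiv L e dV hdV dW hdW v u
  rw [hset]
  exact (isClosed_setOf_isSiegelM L e dV hdV dW hdW v).preimage
    (UnitaryGroup.localPiEquiv L (IsCMField.complexConj L) (n + n) (hermD L e dV hdV dW hdW) v).continuous

set_option maxHeartbeats 400000 in
/-- **the chart identity** `Φ (p · ι_v(g, 1)) = Φ p · ι_v(ψ (Φ_N g), 1)` (`ψ = dualPairInl`, `g ↦ g ⊗ 1`; ★ `localPiEquiv_iotaVLocPi`).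
[cite: HarrisKudlaSweet1996, §1 (1.11)] [cite: Liu2011, §2C p. 863] -/
theorem localPiEquiv_mul_iotaLeftLocPi
    (p : UnitaryGroup.localPi L (IsCMField.complexConj L) (n + n) (hermD L e dV hdV dW hdW) v)
    (g : UnitaryGroup.localPi L (IsCMField.complexConj L) N (Matrix.diagonal dV) v) :
    UnitaryGroup.localPiEquiv L (IsCMField.complexConj L) (n + n) (hermD L e dV hdV dW hdW) v
        (p * iotaLeftLocPi L e dV hdV dW hdW v g) =
      UnitaryGroup.localPiEquiv L (IsCMField.complexConj L) (n + n) (hermD L e dV hdV dW hdW) v p *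
        iotaGGLoc L e dV hdV dW hdW v
          (UnitaryGroup.dualPairInl (UnitaryGroup.conjLocal L (IsCMField.complexConj L) v)
              ((UnitaryGroup.adelicForm L N (Matrix.diagonal dV)).map (UnitaryGroup.adeleToLocal L v))
              ((UnitaryGroup.adelicForm L 1 (Matrix.diagonal dW)).map (UnitaryGroup.adeleToLocal L v))
            (UnitaryGroup.localPiEquiv L (IsCMField.complexConj L) N (Matrix.diagonal dV) v g), 1) := by
  rw [map_mul, iotaLeftLocPi_apply, localPiEquiv_iotaVLocPi, map_one, iotaVLoc, MonoidHom.comp_apply]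
  simp only [MonoidHom.coe_prodMap, Prod.map_apply, map_one]
  rfl

/-- the chart of this file is `Φ⁻¹ ∘ (chart of (B-ii)) ∘ (θ × ψ Φ_N)` (function identity). [cite: HarrisKudlaSweet1996, §1 (1.11)] -/
theorem siegelDeltaLoc_mul_iotaLeftLocPi_eq_comp :
    (fun px : ↥(siegelDeltaLoc L e dV hdV dW hdW v) ×
          UnitaryGroup.localPi L (IsCMField.complexConj L) N (Matrix.diagonal dV) v =>
        (px.1 : UnitaryGroup.localPi L (IsCMField.complexConj L) (n + n) (hermD L e dV hdV dW hdW) v) *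
          iotaLeftLocPi L e dV hdV dW hdW v px.2) =
      (fun y => (UnitaryGroup.localPiEquiv L (IsCMField.complexConj L) (n + n) (hermD L e dV hdV dW hdW) v).symm y) ∘
        (fun px' : {p : UnitaryGroup.«local» L (IsCMField.complexConj L) (n + n) (hermD L e dV hdV dW hdW) v //
              IsSiegelM (n := n) (Units.val (Subtype.val p))} × localPairU L dV dW v =>
          (px'.1.1 : UnitaryGroup.«local» L (IsCMField.complexConj L) (n + n) (hermD L e dV hdV dW hdW) v) *
            iotaGGLoc L e dV hdV dW hdW v (px'.2, 1)) ∘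
        (fun px : ↥(siegelDeltaLoc L e dV hdV dW hdW v) ×
            UnitaryGroup.localPi L (IsCMField.complexConj L) N (Matrix.diagonal dV) v =>
          ((⟨UnitaryGroup.localPiEquiv L (IsCMField.complexConj L) (n + n) (hermD L e dV hdV dW hdW) v px.1.1,
              (mem_siegelDeltaLoc_iff_isSiegelM_localPiEquiv L e dV hdV dW hdW v px.1.1).1 px.1.2⟩ :
              {p : UnitaryGroup.«local» L (IsCMField.complexConj L) (n + n) (hermD L e dV hdV dW hdW) v //
                IsSiegelM (n := n) (Units.val (Subtype.val p))}),
            UnitaryGroup.dualPairInl (UnitaryGroup.conjLocal L (IsCMField.complexConj L) v)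
                ((UnitaryGroup.adelicForm L N (Matrix.diagonal dV)).map (UnitaryGroup.adeleToLocal L v))
                ((UnitaryGroup.adelicForm L 1 (Matrix.diagonal dW)).map (UnitaryGroup.adeleToLocal L v))
              (UnitaryGroup.localPiEquiv L (IsCMField.complexConj L) N (Matrix.diagonal dV) v px.2))) := by
  funext px
  simp only [Function.comp_apply]
  apply (UnitaryGroup.localPiEquiv L (IsCMField.complexConj L) (n + n) (hermD L e dV hdV dW hdW) v).injective
  rw [ContinuousMulEquiv.apply_symm_apply, localPiEquiv_mul_iotaLeftLocPi]

/-! ## §2 The open embedding `P_Δ(L⁺_v) × U(V)(L⁺_v) → H(L⁺_v)` and (D1) -/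

/-- **INJECTIVITY** of `(p, g) ↦ p · ι_v(g, 1)` on `P_Δ(L⁺_v) × U(V)(L⁺_v)` (★ (B-i) `injective_siegel_mul_iotaGGLoc` through the chart
identity; `g ↦ g ⊗ 1` injective ★ `dualPairInl_injective`). [cite: GelbartPiatetskishapiroRallis1987, Part A §1] [cite: Liu2021, Lem. B.11] -/
theorem injective_siegelDeltaLoc_mul_iotaLeftLocPi :
    Function.Injective (fun px : ↥(siegelDeltaLoc L e dV hdV dW hdW v) ×
          UnitaryGroup.localPi L (IsCMField.complexConj L) N (Matrix.diagonal dV) v =>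
        (px.1 : UnitaryGroup.localPi L (IsCMField.complexConj L) (n + n) (hermD L e dV hdV dW hdW) v) *
          iotaLeftLocPi L e dV hdV dW hdW v px.2) := by
  rw [siegelDeltaLoc_mul_iotaLeftLocPi_eq_comp]
  refine (UnitaryGroup.localPiEquiv L (IsCMField.complexConj L) (n + n) (hermD L e dV hdV dW hdW) v).symm.injective.comp
    ((injective_siegel_mul_iotaGGLoc L e dV hdV dW hdW v).comp ?_)
  rintro ⟨p, g⟩ ⟨p', g'⟩ h
  simp only [Prod.mk.injEq, Subtype.mk.injEq] at h
  obtain ⟨hp, hg⟩ := h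
  have hpp : p = p' :=
    Subtype.ext ((UnitaryGroup.localPiEquiv L (IsCMField.complexConj L) (n + n) (hermD L e dV hdV dW hdW) v).injective
      (Subtype.ext (congrArg Subtype.val hp)))
  have hgg : g = g' :=
    (UnitaryGroup.localPiEquiv L (IsCMField.complexConj L) N (Matrix.diagonal dV) v).injective
      (UnitaryGroup.dualPairInl_injective _ _ _ hg)
  rw [hpp, hgg]

omit [IsCMField L] in
/-- `dW 0 ≠ 0` makes the `(⋆, ⋆)` entry of the local line form `(J_W)_v` a unit of `L_v` (input of ★ `isHomeomorph_dualPairInl_of_line`).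
[cite: Liu2021, App. D §D.1] -/
theorem isUnit_lineForm_apply (hdW0 : ∀ i, dW i ≠ 0) :
    IsUnit (((UnitaryGroup.adelicForm L 1 (Matrix.diagonal dW)).map (UnitaryGroup.adeleToLocal L v)) default default) := by
  rw [Matrix.map_apply, UnitaryGroup.adelicForm, Matrix.map_apply, Matrix.diagonal_apply_eq]
  exact ((IsUnit.mk0 _ (hdW0 default)).map (algebraMap L (AdeleRing (𝓞 L) L))).map _

/-- **OPEN MAP**: `(p, g) ↦ p · ι_v(g, 1)` maps open sets of `P_Δ(L⁺_v) × U(V)(L⁺_v)` to open sets of `H(L⁺_v)` (★ (B-ii)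
`isOpenMap_siegel_mul_iotaGGLoc` transported along the homeomorphisms `Φ⁻¹`, `θ`, `ψ Φ_N`). This is the `hΩ` of the (D-fin) local section.
[cite: GelbartPiatetskishapiroRallis1987, Part A §1–§2] [cite: Liu2021, App. D §D.1] -/
theorem isOpenMap_siegelDeltaLoc_mul_iotaLeftLocPi (hdW0 : ∀ i, dW i ≠ 0) (hJ : IsUnit (pairFormLoc L dV dW v).det) :
    IsOpenMap (fun px : ↥(siegelDeltaLoc L e dV hdV dW hdW v) ×
          UnitaryGroup.localPi L (IsCMField.complexConj L) N (Matrix.diagonal dV) v =>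
        (px.1 : UnitaryGroup.localPi L (IsCMField.complexConj L) (n + n) (hermD L e dV hdV dW hdW) v) *
          iotaLeftLocPi L e dV hdV dW hdW v px.2) := by
  rw [siegelDeltaLoc_mul_iotaLeftLocPi_eq_comp]
  have hθ : IsOpenMap (fun p : ↥(siegelDeltaLoc L e dV hdV dW hdW v) =>
      ((⟨UnitaryGroup.localPiEquiv L (IsCMField.complexConj L) (n + n) (hermD L e dV hdV dW hdW) v p.1,
          (mem_siegelDeltaLoc_iff_isSiegelM_localPiEquiv L e dV hdV dW hdW v p.1).1 p.2⟩ :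
          {p : UnitaryGroup.«local» L (IsCMField.complexConj L) (n + n) (hermD L e dV hdV dW hdW) v //
            IsSiegelM (n := n) (Units.val (Subtype.val p))}))) :=
    ((UnitaryGroup.localPiEquiv L (IsCMField.complexConj L) (n + n) (hermD L e dV hdV dW hdW) v).toHomeomorph.subtype
      (p := fun u => u ∈ siegelDeltaLoc L e dV hdV dW hdW v)
      (q := fun p : UnitaryGroup.«local» L (IsCMField.complexConj L) (n + n) (hermD L e dV hdV dW hdW) v =>
        IsSiegelM (n := n) (Units.val (Subtype.val p)))
      (mem_siegelDeltaLoc_iff_isSiegelM_localPiEquiv L e dV hdV dW hdW v)).isOpenMap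
  have hψ : IsOpenMap (fun g : UnitaryGroup.localPi L (IsCMField.complexConj L) N (Matrix.diagonal dV) v =>
      UnitaryGroup.dualPairInl (UnitaryGroup.conjLocal L (IsCMField.complexConj L) v)
          ((UnitaryGroup.adelicForm L N (Matrix.diagonal dV)).map (UnitaryGroup.adeleToLocal L v))
          ((UnitaryGroup.adelicForm L 1 (Matrix.diagonal dW)).map (UnitaryGroup.adeleToLocal L v))
        (UnitaryGroup.localPiEquiv L (IsCMField.complexConj L) N (Matrix.diagonal dV) v g)) :=
    (UnitaryGroup.isHomeomorph_dualPairInl_of_line _ _ _ (isUnit_lineForm_apply L dW v hdW0)).isOpenMap.comp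
      (UnitaryGroup.localPiEquiv L (IsCMField.complexConj L) N (Matrix.diagonal dV) v).toHomeomorph.isOpenMap
  exact (UnitaryGroup.localPiEquiv L (IsCMField.complexConj L) (n + n) (hermD L e dV hdV dW hdW) v).symm.toHomeomorph.isOpenMap.comp
    ((isOpenMap_siegel_mul_iotaGGLoc L e dV hdV dW hdW v hJ).comp (hθ.prodMap hψ))

/-- `(p, g) ↦ p · ι_v(g, 1)` is continuous. [folklore] -/
theorem continuous_siegelDeltaLoc_mul_iotaLeftLocPi :
    Continuous (fun px : ↥(siegelDeltaLoc L e dV hdV dW hdW v) ×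
          UnitaryGroup.localPi L (IsCMField.complexConj L) N (Matrix.diagonal dV) v =>
        (px.1 : UnitaryGroup.localPi L (IsCMField.complexConj L) (n + n) (hermD L e dV hdV dW hdW) v) *
          iotaLeftLocPi L e dV hdV dW hdW v px.2) :=
  (continuous_subtype_val.comp continuous_fst).mul ((continuous_iotaLeftLocPi L e dV hdV dW hdW v).comp continuous_snd)

/-- **(B3) OPEN EMBEDDING** `P_Δ(L⁺_v) × U(V)(L⁺_v) → H(L⁺_v)`, `(p, g) ↦ p · ι_v(g, 1)`, in the restricted-product factor currency
(`W` a line with `dW 0 ≠ 0`; `det 𝕁_v` a unit, §3). [cite: GelbartPiatetskishapiroRallis1987, Part A §1–§2] [cite: Liu2021, §B.3 (B.5), Lem. B.11, App. D §D.1] -/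
theorem isOpenEmbedding_siegelDeltaLoc_mul_iotaLeftLocPi (hdW0 : ∀ i, dW i ≠ 0) (hJ : IsUnit (pairFormLoc L dV dW v).det) :
    IsOpenEmbedding (fun px : ↥(siegelDeltaLoc L e dV hdV dW hdW v) ×
          UnitaryGroup.localPi L (IsCMField.complexConj L) N (Matrix.diagonal dV) v =>
        (px.1 : UnitaryGroup.localPi L (IsCMField.complexConj L) (n + n) (hermD L e dV hdV dW hdW) v) *
          iotaLeftLocPi L e dV hdV dW hdW v px.2) :=
  IsOpenEmbedding.of_continuous_injective_isOpenMap (continuous_siegelDeltaLoc_mul_iotaLeftLocPi L e dV hdV dW hdW v)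
    (injective_siegelDeltaLoc_mul_iotaLeftLocPi L e dV hdV dW hdW v)
    (isOpenMap_siegelDeltaLoc_mul_iotaLeftLocPi L e dV hdV dW hdW v hdW0 hJ)

/-- **RANGE = the main orbit** `{u ∈ H(L⁺_v) | IsUnit M(Φ u)}` (★ (B-ii) `range_siegel_mul_iotaGGLoc` + surjectivity of `θ`, `ψ`, `Φ_N`).
[cite: GelbartPiatetskishapiroRallis1987, Part A §1] [cite: Liu2021, §B.3 (B.5), Lem. B.11] -/
theorem range_siegelDeltaLoc_mul_iotaLeftLocPi (hdW0 : ∀ i, dW i ≠ 0) (hJ : IsUnit (pairFormLoc L dV dW v).det) :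
    Set.range (fun px : ↥(siegelDeltaLoc L e dV hdV dW hdW v) ×
          UnitaryGroup.localPi L (IsCMField.complexConj L) N (Matrix.diagonal dV) v =>
        (px.1 : UnitaryGroup.localPi L (IsCMField.complexConj L) (n + n) (hermD L e dV hdV dW hdW) v) *
          iotaLeftLocPi L e dV hdV dW hdW v px.2) =
      {u | IsUnit ((Matrix.reindex (e₂ (n := n)).symm (e₂ (n := n)).symm (Units.val (Subtype.val
            (UnitaryGroup.localPiEquiv L (IsCMField.complexConj L) (n + n) (hermD L e dV hdV dW hdW) v u)))).toBlocks₂₂ -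
        (Matrix.reindex (e₂ (n := n)).symm (e₂ (n := n)).symm (Units.val (Subtype.val
            (UnitaryGroup.localPiEquiv L (IsCMField.complexConj L) (n + n) (hermD L e dV hdV dW hdW) v u)))).toBlocks₁₂)} := by
  ext u
  constructor
  · rintro ⟨⟨p, g⟩, rfl⟩
    simp only [Set.mem_setOf_eq, localPiEquiv_mul_iotaLeftLocPi]
    exact isUnit_mainOrbitBlock_siegel_mul_iotaGGLoc L e dV hdV dW hdW v _
      ((mem_siegelDeltaLoc_iff_isSiegelM_localPiEquiv L e dV hdV dW hdW v p.1).1 p.2) _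
  · intro hu
    obtain ⟨p', x, hp', hpx⟩ := exists_siegel_mul_iotaGGLoc_eq L e dV hdV dW hdW v hJ _ hu
    obtain ⟨a, ha⟩ := UnitaryGroup.dualPairInl_surjective_of_line
      (UnitaryGroup.conjLocal L (IsCMField.complexConj L) v)
      ((UnitaryGroup.adelicForm L N (Matrix.diagonal dV)).map (UnitaryGroup.adeleToLocal L v))
      ((UnitaryGroup.adelicForm L 1 (Matrix.diagonal dW)).map (UnitaryGroup.adeleToLocal L v))
      (isUnit_lineForm_apply L dW v hdW0) x
    have hp : (UnitaryGroup.localPiEquiv L (IsCMField.complexConj L) (n + n) (hermD L e dV hdV dW hdW) v).symm p' ∈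
        siegelDeltaLoc L e dV hdV dW hdW v := by
      rw [mem_siegelDeltaLoc_iff_isSiegelM_localPiEquiv, ContinuousMulEquiv.apply_symm_apply]
      exact hp'
    refine ⟨(⟨_, hp⟩, (UnitaryGroup.localPiEquiv L (IsCMField.complexConj L) N (Matrix.diagonal dV) v).symm a), ?_⟩
    apply (UnitaryGroup.localPiEquiv L (IsCMField.complexConj L) (n + n) (hermD L e dV hdV dW hdW) v).injective
    simp only [localPiEquiv_mul_iotaLeftLocPi, ContinuousMulEquiv.apply_symm_apply, ha]
    exact hpx

/-- **(D1) `P_Δ(L⁺_v) · ι_v(C, 1)` is CLOSED in `H(L⁺_v)` for every compact `C ⊆ U(V)(L⁺_v)`** (closed subgroup times compact set in a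
topological group; hypothesis-free). [cite: GelbartPiatetskishapiroRallis1987, Part A §1–§2] -/
theorem isClosed_image_siegelDeltaLoc_mul_iotaLeftLocPi_of_isCompact
    {C : Set (UnitaryGroup.localPi L (IsCMField.complexConj L) N (Matrix.diagonal dV) v)} (hC : IsCompact C) :
    IsClosed ((fun px : ↥(siegelDeltaLoc L e dV hdV dW hdW v) ×
          UnitaryGroup.localPi L (IsCMField.complexConj L) N (Matrix.diagonal dV) v =>
        (px.1 : UnitaryGroup.localPi L (IsCMField.complexConj L) (n + n) (hermD L e dV hdV dW hdW) v) *
          iotaLeftLocPi L e dV hdV dW hdW v px.2) '' (Set.univ ×ˢ C)) := by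
  have hset : (fun px : ↥(siegelDeltaLoc L e dV hdV dW hdW v) ×
          UnitaryGroup.localPi L (IsCMField.complexConj L) N (Matrix.diagonal dV) v =>
        (px.1 : UnitaryGroup.localPi L (IsCMField.complexConj L) (n + n) (hermD L e dV hdV dW hdW) v) *
          iotaLeftLocPi L e dV hdV dW hdW v px.2) '' (Set.univ ×ˢ C) =
      (siegelDeltaLoc L e dV hdV dW hdW v :
          Set (UnitaryGroup.localPi L (IsCMField.complexConj L) (n + n) (hermD L e dV hdV dW hdW) v)) *
        ((fun g => iotaLeftLocPi L e dV hdV dW hdW v g) '' C) := by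
    ext z
    constructor
    · rintro ⟨⟨p, x⟩, hmem, rfl⟩
      refine Set.mul_mem_mul ?_ ?_
      · exact p.2
      · exact Set.mem_image_of_mem _ hmem.2
    · rintro ⟨p, hp, _, ⟨x, hx, rfl⟩, rfl⟩
      exact ⟨(⟨p, hp⟩, x), ⟨Set.mem_univ _, hx⟩, rfl⟩
  rw [hset]
  exact (isClosed_siegelDeltaLoc L e dV hdV dW hdW v).mul_right_of_isCompact
    (hC.image (continuous_iotaLeftLocPi L e dV hdV dW hdW v))

end PiLocal

/-! ## §3 `det 𝕁_v` is a unit (discharging `hJ`) -/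

section DetUnit

variable (L : Type) [Field L] [NumberField L] [IsCMField L]
variable {N M : ℕ} (dV : Fin N → L) (dW : Fin M → L) (v : HeightOneSpectrum (𝓞 (Fp L)))

omit [IsCMField L] in
/-- **`det 𝕁_v` is a unit of `L_v`** when `dV i ≠ 0`, `dW j ≠ 0`: `𝕁_v = (diagonal dV ⊗ₖ diagonal dW) ⊗ 1`, whose determinant is the image of the
nonzero field element `(∏ dV)^M (∏ dW)^N`. [cite: HarrisKudlaSweet1996, §1 (1.11)] -/
theorem isUnit_det_pairFormLoc (hdV0 : ∀ i, dV i ≠ 0) (hdW0 : ∀ j, dW j ≠ 0) : IsUnit (pairFormLoc L dV dW v).det := by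
  have h : pairFormLoc L dV dW v = ((UnitaryGroup.adeleToLocal L v).comp (algebraMap L (AdeleRing (𝓞 L) L))).mapMatrix
      (Matrix.diagonal dV ⊗ₖ Matrix.diagonal dW) := by
    rw [← pairFormA_map_adeleToLocal, RingHom.mapMatrix_apply, RingHom.coe_comp, ← Matrix.map_map]
    unfold pairFormA UnitaryGroup.adelicForm
    rw [UnitaryGroup.kronecker_map_map]
  rw [h, ← RingHom.map_det]
  refine (IsUnit.mk0 _ ?_).map _
  rw [Matrix.det_kronecker, Matrix.det_diagonal, Matrix.det_diagonal]
  exact mul_ne_zero (pow_ne_zero _ (Finset.prod_ne_zero_iff.2 fun i _ => hdV0 i))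
    (pow_ne_zero _ (Finset.prod_ne_zero_iff.2 fun j _ => hdW0 j))

end DetUnit

end Summit.HodgeConjecture.HodgeConjecture.Cruxes.HLiu418.K2LiuSiegelBigCellOpenEmbeddingPi

end
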